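import Summits.QuantumFields.YangMills.Theorems.BalabanUVNodesN15CurvedGluingSmoothCutDressedGluedAdjointGauged
import Summits.QuantumFields.YangMills.Theorems.BalabanUVNodesN15CurvedGluingCubeAdjointCovariantEntrySandwich
import HarnessLib

/-!
# N15 = NE2, road (c) — PROGRAMME (PC), towards (PC-A″) «the THIRD sup-norm entry `G′(U)∇*_U` of [B9] (3.42) in per-cube gauges», I′: n15-c∕280's ADJOINT CAPSTONE WITH THE
# COEFFICIENT ROWS OF THE RIGHT FACTOR'S COVARIANT SHAPE LOCALIZED TO THE CUT BOX `{χ_k ≠ 0}` — the form the `U(N)` transporter can meet (dag-n15-c g27, n15-c∕280′)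

Cell `pub-ymgap`, seat `pub-ymgap-dag-n15-c` (generation g27; R134 (a), s1 «first missing estimate»; HUMAN RULING D-0062).  `bears_on: R4∕N15 · K3⁸ SpineGivenEndpointR13SepCoPHV
(stmt-QuantumFields-27366)`; filed `--kind proof --supports stmt-QuantumFields-27366 --as helper` — COUNT-NEUTRAL.  One theorem + two pointwise lemmas, 0 `def`, 0 `sorry`.
SUPERSEDES n15-c∕280 `hasMaj_gluedL_comp_smoothCutDressed_localGauges_cov` (its global rows imply the local ones): there the rows `r_R, r_{∇R}, r_B` of `R_k∘e_ν`, `∇R_k`, `B_k` were asked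
for ALL `x`; for `E = D*_{U,ν}` in the gauge `u_k` they hold only where the gauge is regular (the cut box and its collar), and that is all the proof reads: the sandwiched entry
`T_k` meets the field only through `M_{h_k∘e_ν}`, `supp(h_k∘e_ν) ⊂ {χ_k = 1}`, so `T_k∘M_{χ_k}` replaces `T_k`, and `M_A∘M_{χ_k} = M_{χ_k·A}` has global rows `≤` the local ones.  Imports BY NAME FILE 163
`…SmoothCutDressedGluedAdjointGauged` (through it FILE 160 `hasMaj_gluedL_comp_of_localGauges`, FILE 153 ★★★ `hasMaj_smoothCutDressed_comp_commOp_cubeOp_out_of_sandwich` ∕ ★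
`hasMaj_adjRightEntry_loc₂`, file 34 `hasMaj_smoothCutDressed_loc₂` ∕ `mulOp_comp_smoothCutDressed` ∕ `hasMaj_smoothCut_flat` ∕ `hasMaj_jet_smoothCut_flat`, file 23 `hasMaj_dressedV_pair`,
FILE 148 `isUnit_neumannR`, `commOp_add_left`, `exp_rate_mono`) and FILE 157 `…CubeAdjointCovariantEntrySandwich` (★★ `smoothCutDressed_comp_covShape_bgrad_sandwich`, `cut_sandwich_of_sandwich`,
★ `hasMaj_covShapeEntry_loc₂`).  Nothing in the tree is modified; nothing restated.  The statement and proof are FILE 163's with the four changes listed under WHAT.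

WHY.  [Balaban1985BackgroundPropagators] Thm 3.1 p.397 prints THREE sup-norm entries (3.42): `|G′(U)λ|`, `|(∇_UG′(U)λ)(x)|`, `|(G′(U)∇*_Uλ)(x)|` (the mixed `∇_UG′∇*_U` is Hölder-only,
(3.43)–(3.45)).  For the NAMED `G′(U) = cGreen (cvT e U) a` and `U` in the PRINTED per-cube class (3.35), n15-c∕266 and n15-c∕276∕278 are entries 0 and `∇_UG′`; the third entry
`G′(U)∇*_U` is the located object of HOME HANDOFF § g26 «STATE OF THE PROGRAMME (PC)» (i).  Block sup-majorants are NOT transpose-invariant uniformly in the spacing (g18 FINDING (i)), so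
`G′∇* = (∇G′)ᵀ` is useless and Bałaban's own remedy is the left resummation `G′ = (1 − R̃)⁻¹G₀` ([B6] (2.91)–(2.93)) — FILE 160's adjoint glue across per-cube gauges, FILE 163 its
capstone for the PURE gradient `∇⁻_ν`.  With per-cube gauges the pure gradient is useless too: `M_{u_k}∇⁻_νM_{u_kᵀ} = M_{R₁}∇⁻_ν + M_{B₁}` has `B₁ = O(η⁻¹)` for the ROUGH gauges (3.35)
produces (`u_k` oscillates like `U` itself).  The cure, as on the direct side (n15-c∕268–276: `D := D_{U,μ}`), is to glue the COVARIANT adjoint derivative `E := D*_{U,ν}`: its conjugate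
`M_{u_k}D*_{U,ν}M_{u_kᵀ} = D*_{U^{u_k},ν}` has the covariant shape with `R_k` = the (orthogonal) transporter of `U^{u_k}` and `B_k = a⁻_ν(U^{u_k})` SMALL ON THE CUBE — and the sandwich
`M_{χ_k}X_k(M_{R_k}∇⁻_ν + M_{B_k})M_{h_k∘e_ν}` reads the coefficients only one step around `supp h_k`.  THIS FILE is FILE 163 with `E` abstract: the per-cube covariant shape, the
coefficient rows and the scalar Leibniz rule DISPLAYED; the sequel discharges them on the site carrier of n15-c∕260 (where, moreover, every far∕flat right-locality defect vanishes).

WHAT.  ★★★ `hasMaj_gluedL_comp_smoothCutDressed_localGauges_cov` = FILE 163's theorem with: (a) `(hR1) (hR1′) (hB1)` ↦ `(hleib) (hdh) (hEcov) (hRE) (hRE′) (hBE)`; (b) conclusion `… ∘ₗ E`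
for `… ∘ₗ ∇⁻_ν`; (c) step (4) by FILE 157 ★★ + `cut_sandwich_of_sandwich` after `hEcov`; (d) step (6) (Leibniz) is the hypothesis.  Same constant.

HONEST FRAMING ∕ LIMITS.  Composition of LANDED theorems over DISPLAYED rows — the operator-level content of the third entry of (3.42) with (3.34)–(3.35)'s per-cube gauges as a
CONDITIONAL statement on King's ∕ dag-n15-a's model carriers; proves NO estimate of a concrete propagator; nothing of [B5]∕[B6]∕[B9] asserted ((2.91)–(2.93) p.239, (2.133)–(2.136)
p.247, (3.34)–(3.35) p.396, (3.42) p.397, (3.50)–(3.52) p.400, (3.62)–(3.65) pp.402–403, (3.87)–(3.90) pp.409–410 = SHAPES ∕ MECHANISM).  NE2⁺ NOT PRINTED, NOT proved; N15 of record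
untouched (DISCHARGED AS CONSUMED, p687738); K3⁸ OPEN; counts of record UNMOVED (typed 28∕28 · discharged 8∕27); one finite 𝕋⁴ at fixed ε per index — NOT infinite volume, NOT OS on
ℝ⁴, NOT a mass gap, NOT Clay.  Restate-immune (no Theses import).
-/

set_option autoImplicit false

noncomputable section
open scoped BigOperators Matrix
open Finset

namespace Summit.QuantumFields.YangMills.BalabanUVNodes.N15.Gluing

open Literature.MathematicalPhysics.QuantumFieldTheory.Balaban1983to89
open Literature.MathematicalPhysics.QuantumFieldTheory.Balaban1983to89.B11SectG (BlockNorm HasMaj RowSum)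
open Literature.MathematicalPhysics.QuantumFieldTheory.Balaban1983to89.B6RandomWalk (Triangle254)
open Literature.MathematicalPhysics.QuantumFieldTheory.Balaban1983to89.T4EtaRateCoeffDefect (diagK diagK_nonneg hasMaj_mulOp)
open Literature.MathematicalPhysics.QuantumFieldTheory.Balaban1983to89.B6Prop26Gluing (mulOp mulOp_apply ind ind_nonneg ind_le_one)
open Summit.QuantumFields.YangMills.BalabanUVNodes.N15.MatrixSpecies (mmulOp mmulOp_apply liftBlk liftEquiv liftEquiv_apply liftEquiv_symm_apply)
open Summit.QuantumFields.YangMills.BalabanUVNodes.N15.BackgroundLayer (fgrad bgrad fgradAdj fgrad_apply bgrad_apply stack projO unstackM bgPropV blkPair fgradMat)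
open Summit.QuantumFields.YangMills.BalabanUVNodes.N15.CurvedSpecies (hasMaj_smoothCutDressed_loc₂ mulOp_comp_smoothCutDressed hasMaj_smoothCut_flat hasMaj_jet_smoothCut_flat smoothCut_out
  hasMaj_dressedV_pair)

/-! ## The adjoint capstone with a right factor of displayed per-cube covariant shape -/

section Capstone

variable {X ι J K : Type} [Fintype X] [DecidableEq X] [Fintype ι] [DecidableEq ι] [Fintype J] [DecidableEq J] [Fintype K] {g : B6.Geometry} (blk : X → g.Site) (τ : J → X ≃ X) (n : ℝ) (ν : J)
  {σ cr : ℝ} {N : K → (X × ι → ℝ) →ₗ[ℝ] (X × ι → ℝ)} {C : K → X → Matrix ι ι ℝ} {A : K → J ⊕ J → X → Matrix ι ι ℝ} {NV : K → (X × ι → ℝ) →ₗ[ℝ] (X × ι → ℝ)}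
  {Δ W NL : (X × ι → ℝ) →ₗ[ℝ] (X × ι → ℝ)} {F : K → (X × ι → ℝ) →ₗ[ℝ] (X × ι → ℝ)} {ug : K → X → Matrix ι ι ℝ} {χX χtX ψX ψ₂X hX : K → X → ℝ} {Sk : K → Set g.Site}
  {hb : K → g.Site → ℝ} {Tf Tb : K → J → (X × ι → ℝ) →ₗ[ℝ] (X × ι → ℝ)}
  {E : (X × ι → ℝ) →ₗ[ℝ] (X × ι → ℝ)} {RE BE : K → X → Matrix ι ι ℝ} {dh : K → X → ℝ}

omit [Fintype X] [DecidableEq X] [DecidableEq ι] in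
/-- `M_A∘M_c = M_{c·A}` for an ι-constant scalar `c`. [folklore] -/
theorem mmulOp_comp_mulOp_eq_smul (Am : X → Matrix ι ι ℝ) (c : X → ℝ) : mmulOp Am ∘ₗ mulOp (fun p : X × ι => c p.1) = mmulOp (fun x => c x • Am x) := by
  refine LinearMap.ext fun f => funext fun p => ?_
  simp only [LinearMap.comp_apply, mmulOp_apply, mulOp_apply, Matrix.smul_apply, smul_eq_mul]
  exact Finset.sum_congr rfl fun j _ => by ring

omit [Fintype X] [DecidableEq X] [DecidableEq ι] in
/-- rows of `c·A` everywhere from rows of `A` on `supp c`, `|c| ≤ 1`. [folklore] -/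
theorem rowSum_smul_le_of_loc {Am : X → Matrix ι ι ℝ} {c : X → ℝ} {r : ℝ} (hc : ∀ x, |c x| ≤ 1) (hr : 0 ≤ r) (hA : ∀ x, c x ≠ 0 → ∀ i, ∑ j, |Am x i j| ≤ r) (x : X) (i : ι) :
    ∑ j, |(fun x => c x • Am x) x i j| ≤ r := by
  by_cases h0 : c x = 0
  · simp [h0, hr]
  · calc ∑ j, |(fun x => c x • Am x) x i j| = |c x| * ∑ j, |Am x i j| := by
          rw [Finset.mul_sum]; exact Finset.sum_congr rfl fun j _ => by simp [abs_mul]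
      _ ≤ 1 * r := mul_le_mul (hc x) (hA x h0 i) (Finset.sum_nonneg fun _ _ => abs_nonneg _) zero_le_one
      _ = r := one_mul r
set_option maxHeartbeats 400000 in
/-- ★★★ **A RIGHT FACTOR `E` OF DISPLAYED PER-CUBE COVARIANT SHAPE — COEFFICIENT ROWS ON THE CUT BOX ONLY — THROUGH THE ADJOINT GLUED OPERATOR FROM DRESSED SMOOTH-CUT CUBES IN PER-CUBE
GAUGES, EVERY CUBE ROW BY NAME** (n15-c∕280 with `(hRE) (hRE′) (hBE)` asked only where `χ_k ≠ 0`; proof: n15-c∕280's with the sandwiched entry `T_k` replaced by `T_k∘M_{χ_k}`) —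
FILE 163 `hasMaj_gluedL_bgrad_smoothCutDressed_localGauges` with the pure gradient `∇⁻_ν` and the pure-gauge coefficients `R₁ = u_k·(u_kᵀ∘e⁻¹)`, `B₁` REPLACED by a global operator `E` whose
conjugate in cube `k`'s gauge has the covariant shape `M_{u_k}EM_{u_kᵀ} = M_{R_k}∇⁻_ν + M_{B_k}` (coefficient rows `r_R` of `R_k∘e_ν`, `r_{∇R}` of `∇R_k`, `r_B` of `B_k` — for `E = D*_{U,ν}`
these are the transporter of `U^{u_k}` and its backward `a⁻`-species, bounded ON THE CUBE by (3.35), which is all the cut sandwich reads) and whose scalar adjoint Leibniz rule through the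
partition `M_{h_k}E = EM_{h_k∘e_ν} + M_{dh_k}` (`|dh_k| ≤ c₁`) holds; the sandwich by FILE 157 ★★ `smoothCutDressed_comp_covShape_bgrad_sandwich` + `cut_sandwich_of_sandwich`, everything
else VERBATIM (file 34, FILE 153 ★★★∕★, FILE 157 ★, FILE 160 ★★★): `𝒢_adj∘E ≤ (1 − N_ov|ι|²(Θ + θ_F + ε_F)c_r)⁻¹·N_ov|ι|²(β₂ + β̄′c₁)·c_r·e^{−(ρ₃−2σ)d}`, SAME constant as FILE 163.
[cite: Balaban1985BackgroundPropagators, (3.34)–(3.35) p.396, Thm 3.1 (3.42) p.397 (entry `G′(U)∇*_U`: shape), (3.50)–(3.52) p.400, (3.62)–(3.65) pp.402–403, (3.87)–(3.90) pp.409–410; Balaban1984PropagatorsII, (2.91)–(2.93) p.239, (2.133)–(2.136) p.247 (shapes + mechanism, transposed)] -/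
theorem hasMaj_gluedL_comp_smoothCutDressed_localGauges_cov_loc (htri : Triangle254 g) (hd : ∀ a b : g.Site, 0 ≤ g.dist a b) (hsymm : ∀ y y', g.dist y y' = g.dist y' y)
    (hd0 : ∀ y : g.Site, g.dist y y = 0) (hrow : RowSum g σ cr) (hσ : 0 ≤ σ)
    {ρ₁ ρ₂ ρ₃ ρN δV δN δW ε R c₀ c₁ c₂ θW cN rA RN ℓ ω β β₁ ct δ βQ θA θF εF rR rR' rB Nov : ℝ}
    (hβ : 0 ≤ β) (hβ₁ : 0 ≤ β₁) (hβQ : 0 ≤ βQ) (hct : 0 ≤ ct) (hR : 0 ≤ R) (hcr : 0 ≤ cr) (hc₀ : 0 ≤ c₀) (hc₁ : 0 ≤ c₁) (hc₂ : 0 ≤ c₂) (hθW : 0 ≤ θW) (hcN : 0 ≤ cN) (hrA : 0 ≤ rA)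
    (hRN : 0 ≤ RN) (hℓ : 0 ≤ ℓ) (hω : 0 ≤ ω) (hθA : 0 ≤ θA) (hθF : 0 ≤ θF) (hεF : 0 ≤ εF) (hrR : 0 ≤ rR) (hrR' : 0 ≤ rR') (hrB : 0 ≤ rB) (hNov : 0 ≤ Nov) (hε : 0 < ε)
    (hσρ : σ ≤ ρ₁) (hρ₁V : ρ₁ ≤ δV) (hρ₁G : ρ₁ + σ ≤ δ) (hρ₂ : 0 ≤ ρ₂) (hρ₂₁ : ρ₂ + σ ≤ ρ₁) (hρ₃ : 0 ≤ ρ₃) (hρ₃N : ρ₃ ≤ ρN) (hρ₃V : ρ₃ ≤ δN - ε) (hρ₃₂ : ρ₃ + σ ≤ ρ₂)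
    (hρ₂W : ρ₂ + 2 * σ ≤ δW) (hσρ₃ : 2 * σ ≤ ρ₃)
    -- per cube: cuts (supports over `S_k`, bump letters and insertions, input cuts)
    (hSχ : ∀ k x, χX k x ≠ 0 → blk x ∈ Sk k) (hSψ : ∀ k x, ψX k x ≠ 0 → blk x ∈ Sk k) (hSψ₂ : ∀ k x, ψ₂X k x ≠ 0 → blk x ∈ Sk k) (hχt : ∀ k x, |χtX k x| ≤ 1) (hχ1 : ∀ k x, |χX k x| ≤ 1)
    (hdχt : ∀ k μ p, |fgrad n (liftEquiv (τ μ) ι) (fun p : X × ι => χtX k p.1) p| ≤ ct) (hdχtb : ∀ k μ p, |bgrad n (liftEquiv (τ μ) ι) (fun p : X × ι => χtX k p.1) p| ≤ ct)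
    (hsub : ∀ k, mulOp (fun p : X × ι => χtX k p.1) ∘ₗ mulOp (fun p : X × ι => χX k p.1) = mulOp (fun p : X × ι => χtX k p.1))
    (hχ : ∀ k, mulOp (fun p : X × ι => χX k p.1) ∘ₗ mulOp (fun p : X × ι => χtX k p.1) = mulOp (fun p : X × ι => χtX k p.1))
    (hs : ∀ k μ, mulOp ((fun p : X × ι => χtX k p.1) ∘ (liftEquiv (τ μ) ι)) ∘ₗ mulOp (fun p : X × ι => χX k p.1) = mulOp ((fun p : X × ι => χtX k p.1) ∘ (liftEquiv (τ μ) ι)))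
    (hsb : ∀ k μ, mulOp ((fun p : X × ι => χtX k p.1) ∘ (liftEquiv (τ μ) ι).symm) ∘ₗ mulOp (fun p : X × ι => χX k p.1) = mulOp ((fun p : X × ι => χtX k p.1) ∘ (liftEquiv (τ μ) ι).symm))
    (hdd : ∀ k μ, mulOp (fgrad n (liftEquiv (τ μ) ι) (fun p : X × ι => χtX k p.1)) ∘ₗ mulOp (fun p : X × ι => χX k p.1) = mulOp (fgrad n (liftEquiv (τ μ) ι) (fun p : X × ι => χtX k p.1)))
    (hddb : ∀ k μ, mulOp (bgrad n (liftEquiv (τ μ) ι) (fun p : X × ι => χtX k p.1)) ∘ₗ mulOp (fun p : X × ι => χX k p.1) = mulOp (bgrad n (liftEquiv (τ μ) ι) (fun p : X × ι => χtX k p.1)))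
    (hNψ : ∀ k, N k ∘ₗ mulOp (fun p : X × ι => ψX k p.1) = N k)
    -- per cube: the flat cube's cut rows, SANDWICHED right entries with rows and input cuts
    (hcut : ∀ k, HasMaj (BlockNorm.ofBlocks g (liftBlk blk ι)) (BlockNorm.ofBlocks g (liftBlk blk ι)) (mulOp (fun p : X × ι => χX k p.1) ∘ₗ N k) (fun y y' => ind (Sk k) y * ind (Sk k) y' * (β * Real.exp (-(δ * g.dist y y')))))
    (hcutF : ∀ k μ, HasMaj (BlockNorm.ofBlocks g (liftBlk blk ι)) (BlockNorm.ofBlocks g (liftBlk blk ι)) (mulOp (fun p : X × ι => χX k p.1) ∘ₗ (fgrad n (liftEquiv (τ μ) ι) ∘ₗ N k)) (fun y y' => ind (Sk k) y * ind (Sk k) y' * (β₁ * Real.exp (-(δ * g.dist y y')))))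
    (hcutB : ∀ k μ, HasMaj (BlockNorm.ofBlocks g (liftBlk blk ι)) (BlockNorm.ofBlocks g (liftBlk blk ι)) (mulOp (fun p : X × ι => χX k p.1) ∘ₗ (bgrad n (liftEquiv (τ μ) ι) ∘ₗ N k)) (fun y y' => ind (Sk k) y * ind (Sk k) y' * (β₁ * Real.exp (-(δ * g.dist y y')))))
    (hTf : ∀ k μ, N k ∘ₗ fgrad n (liftEquiv (τ μ) ι) ∘ₗ mulOp (fun p : X × ι => χX k p.1) = Tf k μ ∘ₗ mulOp (fun p : X × ι => χX k p.1))
    (hTb : ∀ k μ, N k ∘ₗ bgrad n (liftEquiv (τ μ) ι) ∘ₗ mulOp (fun p : X × ι => χX k p.1) = Tb k μ ∘ₗ mulOp (fun p : X × ι => χX k p.1))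
    (hTfr : ∀ k μ, HasMaj (BlockNorm.ofBlocks g (liftBlk blk ι)) (BlockNorm.ofBlocks g (liftBlk blk ι)) (Tf k μ) (fun y y' => ind (Sk k) y * ind (Sk k) y' * (βQ * Real.exp (-(δW * g.dist y y')))))
    (hTbr : ∀ k μ, HasMaj (BlockNorm.ofBlocks g (liftBlk blk ι)) (BlockNorm.ofBlocks g (liftBlk blk ι)) (Tb k μ) (fun y y' => ind (Sk k) y * ind (Sk k) y' * (βQ * Real.exp (-(δW * g.dist y y')))))
    (hTfψ : ∀ k μ, Tf k μ ∘ₗ mulOp (fun p : X × ι => ψ₂X k p.1) = Tf k μ) (hTbψ : ∀ k μ, Tb k μ ∘ₗ mulOp (fun p : X × ι => ψ₂X k p.1) = Tb k μ)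
    -- per cube: the perturbation's letter, smallness, the adjoint letter of `𝒲_k`
    (hV : ∀ k, HasMaj (BlockNorm.ofBlocks g (blkPair (liftBlk blk ι))) (BlockNorm.ofBlocks g (liftBlk blk ι)) (unstackM (C k) (A k) + NV k ∘ₗ projO (none : Option (J ⊕ J))) (fun y y' => R * Real.exp (-(δV * g.dist y y'))))
    (hq : (β + (β₁ + ct * β)) * (R * cr) * cr < 1)
    (hW𝒲 : ∀ k, HasMaj (BlockNorm.ofBlocks g (liftBlk blk ι)) (BlockNorm.ofBlocks g (liftBlk blk ι))
      ((mulOp (fun p : X × ι => χtX k p.1) ∘ₗ N k) ∘ₗ (unstackM (C k) (A k) + NV k ∘ₗ projO (none : Option (J ⊕ J))) ∘ₗ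
        stack LinearMap.id (fun j => Sum.elim (fun μ => fgrad n (liftEquiv (τ μ) ι)) (fun μ => bgrad n (liftEquiv (τ μ) ι)) j) ∘ₗ mulOp (fun p : X × ι => χX k p.1))
      (fun y y' => θA * Real.exp (-(δW * g.dist y y')))) (hqA : θA * cr < 1)
    -- per cube: the partition and its transition layers inside the cut (also shifted by `e_ν`)
    (hhabs : ∀ k x, |hX k x| ≤ 1) (hhcut : ∀ k, mulOp (fun p : X × ι => hX k p.1) ∘ₗ mulOp (fun p : X × ι => χX k p.1) = mulOp (fun p : X × ι => hX k p.1))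
    (hh1 : ∀ k μ x, |fgrad n (τ μ) (hX k) x| ≤ c₁) (hh1b : ∀ k μ x, |bgrad n (τ μ) (hX k) x| ≤ c₁) (hh0 : ∀ k μ x, |hX k (τ μ x) - hX k x| ≤ c₀)
    (hLip : ∀ k y y', |hb k y - hb k y'| ≤ ℓ * g.dist y y') (hrh : ∀ k x, |hX k x - hb k (blk x)| ≤ ω)
    (hh2 : ∀ k μ p, |fgradAdj n (liftEquiv (τ μ) ι) (fgrad n (liftEquiv (τ μ) ι) (fun p : X × ι => hX k p.1)) p| ≤ c₂)
    (hh2f : ∀ k μ p, |fgrad n (liftEquiv (τ μ) ι) (fgrad n (liftEquiv (τ μ) ι) (fun p : X × ι => hX k p.1)) p| ≤ c₂)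
    (hh2b : ∀ k μ p, |bgrad n (liftEquiv (τ μ) ι) (bgrad n (liftEquiv (τ μ) ι) (fun p : X × ι => hX k p.1) ∘ ⇑(liftEquiv (τ μ) ι)) p| ≤ c₂)
    (hlayf : ∀ k μ x, hX k x ≠ hX k ((τ μ).symm x) → χX k x = 1) (hlayb : ∀ k μ x, hX k (τ μ x) ≠ hX k x → χX k x = 1) (hlayν : ∀ k x, hX k (τ ν x) ≠ 0 → χX k x = 1)
    -- per cube: species rows, `W`-row, the flat nonlocal commutator letter, base part; overlap
    (hA : ∀ k j x i, ∑ l, |A k j x i l| ≤ rA)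
    (hWrow : ∀ k, HasMaj (BlockNorm.ofBlocks g (liftBlk blk ι)) (BlockNorm.ofBlocks g (liftBlk blk ι)) ((projO none ∘ₗ bgPropV (stack (mulOp (fun p : X × ι => χtX k p.1) ∘ₗ N k) (fun j => Sum.elim (fun μ => fgrad n (liftEquiv (τ μ) ι)) (fun μ => bgrad n (liftEquiv (τ μ) ι)) j ∘ₗ (mulOp (fun p : X × ι => χtX k p.1) ∘ₗ N k))) (unstackM (C k) (A k) + NV k ∘ₗ projO (none : Option (J ⊕ J)))) ∘ₗ commOp W (fun p : X × ι => hX k p.1)) (fun y y' => ind (Sk k) y * ind (Sk k) y' * (θW * Real.exp (-(ρ₂ * g.dist y y')))))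
    (hKN : ∀ k, HasMaj (BlockNorm.ofBlocks g (liftBlk blk ι)) (BlockNorm.ofBlocks g (liftBlk blk ι)) (commOp NL (fun p : X × ι => hX k p.1)) (fun y y' => cN * Real.exp (-(ρN * g.dist y y'))))
    (hNV : ∀ k, HasMaj (BlockNorm.ofBlocks g (liftBlk blk ι)) (BlockNorm.ofBlocks g (liftBlk blk ι)) (NV k) (fun y y' => RN * Real.exp (-(δN * g.dist y y'))))
    (hN : ∀ a, ∑ k, ind (Sk k) a ≤ Nov)
    -- per cube: the ORTHOGONAL gauge, the GLOBAL operator read in it, the far defect's two adjoint rows, the pure-gauge coefficients' rows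
    (hug : ∀ k x, ug k x * (ug k x)ᵀ = 1) (hug' : ∀ k x, (ug k x)ᵀ * ug k x = 1)
    (hcov : ∀ k, mmulOp (ug k) ∘ₗ Δ ∘ₗ mmulOp (fun x => (ug k x)ᵀ) = (lapOp n (fun μ => liftEquiv (τ μ) ι) W + NL - (unstackM (C k) (A k) + NV k ∘ₗ projO (none : Option (J ⊕ J))) ∘ₗ stack LinearMap.id (fun j => Sum.elim (fun μ => fgrad n (liftEquiv (τ μ) ι)) (fun μ => bgrad n (liftEquiv (τ μ) ι)) j)) + F k)
    (hFK : ∀ k, HasMaj (BlockNorm.ofBlocks g (liftBlk blk ι)) (BlockNorm.ofBlocks g (liftBlk blk ι)) ((projO none ∘ₗ bgPropV (stack (mulOp (fun p : X × ι => χtX k p.1) ∘ₗ N k) (fun j => Sum.elim (fun μ => fgrad n (liftEquiv (τ μ) ι)) (fun μ => bgrad n (liftEquiv (τ μ) ι)) j ∘ₗ (mulOp (fun p : X × ι => χtX k p.1) ∘ₗ N k))) (unstackM (C k) (A k) + NV k ∘ₗ projO (none : Option (J ⊕ J)))) ∘ₗ commOp (F k) (fun p : X × ι => hX k p.1)) (fun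 y y' => ind (Sk k) y * (θF * Real.exp (-(ρ₃ * g.dist y y')))))
    (hFX : ∀ k, HasMaj (BlockNorm.ofBlocks g (liftBlk blk ι)) (BlockNorm.ofBlocks g (liftBlk blk ι)) ((projO none ∘ₗ bgPropV (stack (mulOp (fun p : X × ι => χtX k p.1) ∘ₗ N k) (fun j => Sum.elim (fun μ => fgrad n (liftEquiv (τ μ) ι)) (fun μ => bgrad n (liftEquiv (τ μ) ι)) j ∘ₗ (mulOp (fun p : X × ι => χtX k p.1) ∘ₗ N k))) (unstackM (C k) (A k) + NV k ∘ₗ projO (none : Option (J ⊕ J)))) ∘ₗ F k ∘ₗ mulOp (fun p : X × ι => hX k p.1)) (fun y y' => ind (Sk k) y * ind (Sk k) y' * (εF * Real.exp (-(ρ₃ * g.dist y y')))))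
    -- THE RIGHT FACTOR `E` (global): its scalar adjoint Leibniz rule through the partition and its PER-CUBE COVARIANT SHAPE `M_{u_k}EM_{u_kᵀ} = M_{R_k}∇⁻_ν + M_{B_k}` with coefficient rows
    (hleib : ∀ k, mulOp (fun p : X × ι => hX k p.1) ∘ₗ E = E ∘ₗ mulOp (fun p : X × ι => hX k (τ ν p.1)) + mulOp (fun p : X × ι => dh k p.1)) (hdh : ∀ k x, |dh k x| ≤ c₁)
    (hEcov : ∀ k, mmulOp (ug k) ∘ₗ E ∘ₗ mmulOp (fun x => (ug k x)ᵀ) = mmulOp (RE k) ∘ₗ bgrad n (liftEquiv (τ ν) ι) + mmulOp (BE k))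
    (hRE : ∀ k x, χX k x ≠ 0 → ∀ i, ∑ j, |(RE k ∘ ⇑(τ ν)) x i j| ≤ rR) (hRE' : ∀ k x, χX k x ≠ 0 → ∀ i, ∑ j, |(fgradMat n (τ ν) (RE k)) x i j| ≤ rR')
    (hBE : ∀ k x, χX k x ≠ 0 → ∀ i, ∑ j, |BE k x i j| ≤ rB)
    (hqL : Nov * ((Fintype.card ι : ℝ) ^ 2 * ((((((Fintype.card J : ℝ) * (3 * ((β + (β₁ + ct * β)) * (1 - (β + (β₁ + ct * β)) * (R * cr) * cr)⁻¹ * c₂) + 2 * (((1 - θA * cr)⁻¹ * βQ * cr) * c₁)) + θW)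
          + (β + (β₁ + ct * β)) * (1 - (β + (β₁ + ct * β)) * (R * cr) * cr)⁻¹ * cN * cr)
        + (((Fintype.card J : ℝ) * (2 * rA * (c₁ * ((β + (β₁ + ct * β)) * (1 - (β + (β₁ + ct * β)) * (R * cr) * cr)⁻¹) + c₀ * ((1 - θA * cr)⁻¹ * βQ * cr))))
          + (β + (β₁ + ct * β)) * (1 - (β + (β₁ + ct * β)) * (R * cr) * cr)⁻¹ * ((ℓ * (Real.exp 1 * ε)⁻¹ + 2 * ω) * RN) * cr))) + θF) + (Fintype.card ι : ℝ) ^ 2 * εF) * cr < 1) :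
    HasMaj (BlockNorm.ofBlocks g (liftBlk blk ι)) (BlockNorm.ofBlocks g (liftBlk blk ι))
      (glueInvL (remainderL Δ (fun k => fun p : X × ι => hX k p.1) (fun k => (mmulOp (fun x => (ug k x)ᵀ) ∘ₗ (projO none ∘ₗ bgPropV (stack (mulOp (fun p : X × ι => χtX k p.1) ∘ₗ N k) (fun j => Sum.elim (fun μ => fgrad n (liftEquiv (τ μ) ι)) (fun μ => bgrad n (liftEquiv (τ μ) ι)) j ∘ₗ (mulOp (fun p : X × ι => χtX k p.1) ∘ₗ N k))) (unstackM (C k) (A k) + NV k ∘ₗ projO (none : Option (J ⊕ J)))) ∘ₗ mmulOp (ug k))) -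
          ∑ k, mulOp (fun p : X × ι => hX k p.1) ∘ₗ (mmulOp (fun x => (ug k x)ᵀ) ∘ₗ ((projO none ∘ₗ bgPropV (stack (mulOp (fun p : X × ι => χtX k p.1) ∘ₗ N k) (fun j => Sum.elim (fun μ => fgrad n (liftEquiv (τ μ) ι)) (fun μ => bgrad n (liftEquiv (τ μ) ι)) j ∘ₗ (mulOp (fun p : X × ι => χtX k p.1) ∘ₗ N k))) (unstackM (C k) (A k) + NV k ∘ₗ projO (none : Option (J ⊕ J)))) ∘ₗ F k ∘ₗ mulOp (fun p : X × ι => hX k p.1)) ∘ₗ mmulOp (ug k)))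
        (parametrix (fun k => fun p : X × ι => hX k p.1) (fun k => (mmulOp (fun x => (ug k x)ᵀ) ∘ₗ (projO none ∘ₗ bgPropV (stack (mulOp (fun p : X × ι => χtX k p.1) ∘ₗ N k) (fun j => Sum.elim (fun μ => fgrad n (liftEquiv (τ μ) ι)) (fun μ => bgrad n (liftEquiv (τ μ) ι)) j ∘ₗ (mulOp (fun p : X × ι => χtX k p.1) ∘ₗ N k))) (unstackM (C k) (A k) + NV k ∘ₗ projO (none : Option (J ⊕ J)))) ∘ₗ mmulOp (ug k)))) ∘ₗ E)
      (fun y y' => (1 - Nov * ((Fintype.card ι : ℝ) ^ 2 * ((((((Fintype.card J : ℝ) * (3 * ((β + (β₁ + ct * β)) * (1 - (β + (β₁ + ct * β)) * (R * cr) * cr)⁻¹ * c₂) + 2 * (((1 - θA * cr)⁻¹ * βQ * cr) * c₁)) + θW)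
          + (β + (β₁ + ct * β)) * (1 - (β + (β₁ + ct * β)) * (R * cr) * cr)⁻¹ * cN * cr)
        + (((Fintype.card J : ℝ) * (2 * rA * (c₁ * ((β + (β₁ + ct * β)) * (1 - (β + (β₁ + ct * β)) * (R * cr) * cr)⁻¹) + c₀ * ((1 - θA * cr)⁻¹ * βQ * cr))))
          + (β + (β₁ + ct * β)) * (1 - (β + (β₁ + ct * β)) * (R * cr) * cr)⁻¹ * ((ℓ * (Real.exp 1 * ε)⁻¹ + 2 * ω) * RN) * cr))) + θF) + (Fintype.card ι : ℝ) ^ 2 * εF) * cr)⁻¹ * (Nov * ((Fintype.card ι : ℝ) ^ 2 * (((1 - θA * cr)⁻¹ * βQ * cr) * rR + ((β + (β₁ + ct * β)) * (1 - (β + (β₁ + ct * β)) * (R * cr) * cr)⁻¹) * rR' + ((β + (β₁ + ct * β)) * (1 - (β + (β₁ + ct * β)) * (R * cr) * cr)⁻¹) * rB) * 1 + (Fintype.card ι : ℝ) ^ 2 * ((β + (β₁ + ct * β)) * (1 - (β + (β₁ + ct * β)) * (R * cr) * cr)⁻¹) * c₁)) * cr *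
        Real.exp (-((ρ₃ - 2 * σ) * g.dist y y'))) := by
  have hβb : 0 ≤ β + (β₁ + ct * β) := by positivity
  have hB : 0 ≤ ((β + (β₁ + ct * β)) * (1 - (β + (β₁ + ct * β)) * (R * cr) * cr)⁻¹) := mul_nonneg hβb (inv_nonneg.2 (by linarith))
  have hinv : 0 ≤ (1 - θA * cr)⁻¹ := inv_nonneg.2 (by linarith)
  have hBX : 0 ≤ ((1 - θA * cr)⁻¹ * βQ * cr) := mul_nonneg (mul_nonneg hinv hβQ) hcr
  have hΘ : 0 ≤ ((((Fintype.card J : ℝ) * (3 * ((β + (β₁ + ct * β)) * (1 - (β + (β₁ + ct * β)) * (R * cr) * cr)⁻¹ * c₂) + 2 * (((1 - θA * cr)⁻¹ * βQ * cr) * c₁)) + θW)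
          + (β + (β₁ + ct * β)) * (1 - (β + (β₁ + ct * β)) * (R * cr) * cr)⁻¹ * cN * cr)
        + (((Fintype.card J : ℝ) * (2 * rA * (c₁ * ((β + (β₁ + ct * β)) * (1 - (β + (β₁ + ct * β)) * (R * cr) * cr)⁻¹) + c₀ * ((1 - θA * cr)⁻¹ * βQ * cr))))
          + (β + (β₁ + ct * β)) * (1 - (β + (β₁ + ct * β)) * (R * cr) * cr)⁻¹ * ((ℓ * (Real.exp 1 * ε)⁻¹ + 2 * ω) * RN) * cr)) := by positivity
  have h2σ : 2 * σ ≤ δW := by linarith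
  -- the units, per cube
  have hGf := fun k => hasMaj_smoothCut_flat blk (S := Sk k) hβ hβ₁ hct (hχt k) (hsub k) (hcut k)
  have hDf := fun k => hasMaj_jet_smoothCut_flat blk τ n (S := Sk k) hβ hβ₁ hct (hχt k) (hdχt k) (hdχtb k) (hs k) (hsb k) (hdd k) (hddb k) (hcut k) (hcutF k) (hcutB k)
  have hunit := fun k => (hasMaj_dressedV_pair blk htri hd hrow hσ hβb hR hcr hσρ hρ₁V hρ₁G hρ₂ hρ₂₁ (hGf k) (hDf k) (hV k) hq).1
  have hunitW := fun k => isUnit_neumannR (liftBlk blk ι) hd hrow hθA (by linarith) (hW𝒲 k) hqA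
  have hDj : ∀ k, ∀ j, (fun j => Sum.elim (fun μ => fgrad n (liftEquiv (τ μ) ι)) (fun μ => bgrad n (liftEquiv (τ μ) ι)) j ∘ₗ (mulOp (fun p : X × ι => χtX k p.1) ∘ₗ N k)) j = (fun j => Sum.elim (fun μ => fgrad n (liftEquiv (τ μ) ι)) (fun μ => bgrad n (liftEquiv (τ μ) ι)) j) j ∘ₗ (mulOp (fun p : X × ι => χtX k p.1) ∘ₗ N k) := fun _ _ => rfl
  have rate : ∀ (T : Set g.Site) {c ρ' : ℝ}, 0 ≤ c → ρ₃ ≤ ρ' → ∀ y y' : g.Site,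
      ind T y * ind T y' * (c * Real.exp (-(ρ' * g.dist y y'))) ≤ ind T y * ind T y' * (c * Real.exp (-(ρ₃ * g.dist y y'))) :=
    fun T c ρ' hc hρ y y' => mul_le_mul_of_nonneg_left (exp_rate_mono hd hc hρ y y') (mul_nonneg (ind_nonneg _ _) (ind_nonneg _ _))
  -- (1) each dressed cube's two-sided row (file 34) and its cut row (`M_χX = X`), weakened to the rate `ρ₃`
  have hXr : ∀ k, HasMaj (BlockNorm.ofBlocks g (liftBlk blk ι)) (BlockNorm.ofBlocks g (liftBlk blk ι)) (projO none ∘ₗ bgPropV (stack (mulOp (fun p : X × ι => χtX k p.1) ∘ₗ N k) (fun j => Sum.elim (fun μ => fgrad n (liftEquiv (τ μ) ι)) (fun μ => bgrad n (liftEquiv (τ μ) ι)) j ∘ₗ (mulOp (fun p : X × ι => χtX k p.1) ∘ₗ N k))) (unstackM (C k) (A k) + NV k ∘ₗ projO (none : Option (J ⊕ J)))) (fun y y' => ind (Sk k) y * ind (Sk k) y' * (((β + (β₁ + ct * β)) * (1 - (β + (β₁ + ct * β)) * (R * cr) * cr)⁻¹) * Real.exp (-(ρ₃ * g.dist y y'))))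 := fun k =>
    (hasMaj_smoothCutDressed_loc₂ blk τ n htri hd hrow hσ hβ hβ₁ hct hR hcr hσρ hρ₁V hρ₁G hρ₂ hρ₂₁ (hSχ k) (hSψ k) (hχt k) (hdχt k) (hdχtb k) (hsub k) (hχ k) (hs k)
      (hsb k) (hdd k) (hddb k) (hNψ k) (hcut k) (hcutF k) (hcutB k) (hV k) hq).mono (rate (Sk k) hB (by linarith))
  have hGc : ∀ k, HasMaj (BlockNorm.ofBlocks g (liftBlk blk ι)) (BlockNorm.ofBlocks g (liftBlk blk ι)) (mulOp (fun p : X × ι => χX k p.1) ∘ₗ (projO none ∘ₗ bgPropV (stack (mulOp (fun p : X × ι => χtX k p.1) ∘ₗ N k) (fun j => Sum.elim (fun μ => fgrad n (liftEquiv (τ μ) ι)) (fun μ => bgrad n (liftEquiv (τ μ) ι)) j ∘ₗ (mulOp (fun p : X × ι => χtX k p.1) ∘ₗ N k))) (unstackM (C k) (A k) + NV k ∘ₗ projO (none : Option (J ⊕ J))))) (fun y y' => ind (Sk k) y * ind (Sk k) y' * (((β + (β₁ + ct * β)) * (1 - (β + (β₁ + ct * β)) * (R * cr) * cr)⁻¹)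 * Real.exp (-(ρ₃ * g.dist y y')))) := fun k => by
    rw [mulOp_comp_smoothCutDressed τ n (hχ k) (hNψ k) (hunit k)]
    exact hXr k
  -- (2) the sandwiched adjoint right entry `T^X_k = Ñ_𝒲∘M_χ̃∘T⁻_ν` and its row (FILE 153 ★), at the rate `ρ₃`
  have hWχ : ∀ k, mulOp (fun p : X × ι => χX k p.1) ∘ₗ ((mulOp (fun p : X × ι => χtX k p.1) ∘ₗ N k) ∘ₗ (unstackM (C k) (A k) + NV k ∘ₗ projO (none : Option (J ⊕ J))) ∘ₗ
        stack LinearMap.id (fun j => Sum.elim (fun μ => fgrad n (liftEquiv (τ μ) ι)) (fun μ => bgrad n (liftEquiv (τ μ) ι)) j) ∘ₗ mulOp (fun p : X × ι => χX k p.1)) =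
      ((mulOp (fun p : X × ι => χtX k p.1) ∘ₗ N k) ∘ₗ (unstackM (C k) (A k) + NV k ∘ₗ projO (none : Option (J ⊕ J))) ∘ₗ
        stack LinearMap.id (fun j => Sum.elim (fun μ => fgrad n (liftEquiv (τ μ) ι)) (fun μ => bgrad n (liftEquiv (τ μ) ι)) j) ∘ₗ mulOp (fun p : X × ι => χX k p.1)) := fun k => by
    simp only [← LinearMap.comp_assoc]
    rw [hχ k]
  have hTX : ∀ k, HasMaj (BlockNorm.ofBlocks g (liftBlk blk ι)) (BlockNorm.ofBlocks g (liftBlk blk ι)) (neumannR ((mulOp (fun p : X × ι => χtX k p.1) ∘ₗ N k) ∘ₗ (unstackM (C k) (A k) + NV k ∘ₗ projO (none : Option (J ⊕ J))) ∘ₗ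
        stack LinearMap.id (fun j => Sum.elim (fun μ => fgrad n (liftEquiv (τ μ) ι)) (fun μ => bgrad n (liftEquiv (τ μ) ι)) j) ∘ₗ mulOp (fun p : X × ι => χX k p.1)) ∘ₗ (mulOp (fun p : X × ι => χtX k p.1) ∘ₗ Tb k ν)) (fun y y' => ind (Sk k) y * ind (Sk k) y' * (((1 - θA * cr)⁻¹ * βQ * cr) * Real.exp (-(ρ₃ * g.dist y y')))) := fun k =>
    (hasMaj_adjRightEntry_loc₂ blk htri hd hd0 hrow hσ hcr (hSχ k) (hSψ₂ k) (hχt k) (hWχ k) (hχ k) (hTbψ k ν) hβQ hθA h2σ (hW𝒲 k) (hTbr k ν) hqA).mono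
      (rate (Sk k) hBX (by linarith))
  -- (3) the sandwiched covariant-shaped entry `T₂,k`, its row (FILE 157 ★), and the cut `M_χT₂,k`
  -- (3′) the coefficient rows, weighted by the cut: global rows from the local ones
  have hREg : ∀ k x i, ∑ j, |(fun x => χX k x • (RE k ∘ ⇑(τ ν)) x) x i j| ≤ rR := fun k => rowSum_smul_le_of_loc (hχ1 k) hrR (hRE k)
  have hRE'g : ∀ k x i, ∑ j, |(fun x => χX k x • (fgradMat n (τ ν) (RE k)) x) x i j| ≤ rR' := fun k => rowSum_smul_le_of_loc (hχ1 k) hrR' (hRE' k)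
  have hBEg : ∀ k x i, ∑ j, |(fun x => χX k x • BE k x) x i j| ≤ rB := fun k => rowSum_smul_le_of_loc (hχ1 k) hrB (hBE k)
  have hTχ : ∀ k, ((neumannR ((mulOp (fun p : X × ι => χtX k p.1) ∘ₗ N k) ∘ₗ (unstackM (C k) (A k) + NV k ∘ₗ projO (none : Option (J ⊕ J))) ∘ₗ
        stack LinearMap.id (fun j => Sum.elim (fun μ => fgrad n (liftEquiv (τ μ) ι)) (fun μ => bgrad n (liftEquiv (τ μ) ι)) j) ∘ₗ mulOp (fun p : X × ι => χX k p.1)) ∘ₗ (mulOp (fun p : X × ι => χtX k p.1) ∘ₗ Tb k ν)) ∘ₗ mmulOp (RE k ∘ ⇑(τ ν)) - (projO none ∘ₗ bgPropV (stack (mulOp (fun p : X × ι => χtX k p.1) ∘ₗ N k) (fun j => Sum.elim (fun μ => fgrad n (liftEquiv (τ μ) ι)) (fun μ => bgrad n (liftEquiv (τ μ) ι)) j ∘ₗ (mulOp (fun p : X × ι => χtX k p.1) ∘ₗ N k))) (unstackM (C k) (A k) + NV k ∘ₗ projO (none : Option (J ⊕ J)))) ∘ₗ mmulOp (fgradMat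 n (τ ν) (RE k)) + (projO none ∘ₗ bgPropV (stack (mulOp (fun p : X × ι => χtX k p.1) ∘ₗ N k) (fun j => Sum.elim (fun μ => fgrad n (liftEquiv (τ μ) ι)) (fun μ => bgrad n (liftEquiv (τ μ) ι)) j ∘ₗ (mulOp (fun p : X × ι => χtX k p.1) ∘ₗ N k))) (unstackM (C k) (A k) + NV k ∘ₗ projO (none : Option (J ⊕ J)))) ∘ₗ mmulOp (BE k)) ∘ₗ mulOp (fun p : X × ι => χX k p.1) =
      (neumannR ((mulOp (fun p : X × ι => χtX k p.1) ∘ₗ N k) ∘ₗ (unstackM (C k) (A k) + NV k ∘ₗ projO (none : Option (J ⊕ J))) ∘ₗ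
        stack LinearMap.id (fun j => Sum.elim (fun μ => fgrad n (liftEquiv (τ μ) ι)) (fun μ => bgrad n (liftEquiv (τ μ) ι)) j) ∘ₗ mulOp (fun p : X × ι => χX k p.1)) ∘ₗ (mulOp (fun p : X × ι => χtX k p.1) ∘ₗ Tb k ν)) ∘ₗ mmulOp (fun x => χX k x • (RE k ∘ ⇑(τ ν)) x) - (projO none ∘ₗ bgPropV (stack (mulOp (fun p : X × ι => χtX k p.1) ∘ₗ N k) (fun j => Sum.elim (fun μ => fgrad n (liftEquiv (τ μ) ι)) (fun μ => bgrad n (liftEquiv (τ μ) ι)) j ∘ₗ (mulOp (fun p : X × ι => χtX k p.1) ∘ₗ N k))) (unstackM (C k) (A k) + NV k ∘ₗ projO (none : Option (J ⊕ J)))) ∘ₗ mmulOp (fun x => χX k x • (fgradMat n (τ ν) (RE k)) x) + (projO none ∘ₗ bgPropV (stack (mulOp (fun p : X × ι => χtX k p.1) ∘ₗ N k) (fun j => Sum.elim (fun μ => fgrad n (liftEquiv (τ μ) ι)) (fun μ => bgrad n (liftEquiv (τ μ) ι)) j ∘ₗ (mulOp (fun p : X × ι => χtX k p.1) ∘ₗ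 N k))) (unstackM (C k) (A k) + NV k ∘ₗ projO (none : Option (J ⊕ J)))) ∘ₗ mmulOp (fun x => χX k x • BE k x) := fun k => by
    simp only [LinearMap.add_comp, LinearMap.sub_comp, LinearMap.comp_assoc, mmulOp_comp_mulOp_eq_smul]
  have hT2 : ∀ k, HasMaj (BlockNorm.ofBlocks g (liftBlk blk ι)) (BlockNorm.ofBlocks g (liftBlk blk ι)) ((neumannR ((mulOp (fun p : X × ι => χtX k p.1) ∘ₗ N k) ∘ₗ (unstackM (C k) (A k) + NV k ∘ₗ projO (none : Option (J ⊕ J))) ∘ₗ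
        stack LinearMap.id (fun j => Sum.elim (fun μ => fgrad n (liftEquiv (τ μ) ι)) (fun μ => bgrad n (liftEquiv (τ μ) ι)) j) ∘ₗ mulOp (fun p : X × ι => χX k p.1)) ∘ₗ (mulOp (fun p : X × ι => χtX k p.1) ∘ₗ Tb k ν)) ∘ₗ mmulOp (fun x => χX k x • (RE k ∘ ⇑(τ ν)) x) - (projO none ∘ₗ bgPropV (stack (mulOp (fun p : X × ι => χtX k p.1) ∘ₗ N k) (fun j => Sum.elim (fun μ => fgrad n (liftEquiv (τ μ) ι)) (fun μ => bgrad n (liftEquiv (τ μ) ι)) j ∘ₗ (mulOp (fun p : X × ι => χtX k p.1) ∘ₗ N k))) (unstackM (C k) (A k) + NV k ∘ₗ projO (none : Option (J ⊕ J)))) ∘ₗ mmulOp (fun x => χX k x • (fgradMat n (τ ν) (RE k)) x) + (projO none ∘ₗ bgPropV (stack (mulOp (fun p : X × ι => χtX k p.1) ∘ₗ N k) (fun j => Sum.elim (fun μ => fgrad n (liftEquiv (τ μ) ι)) (fun μ => bgrad n (liftEquiv (τ μ) ι)) j ∘ₗ (mulOp (fun p : X × ι => χtX k p.1) ∘ₗ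 N k))) (unstackM (C k) (A k) + NV k ∘ₗ projO (none : Option (J ⊕ J)))) ∘ₗ mmulOp (fun x => χX k x • BE k x)) (fun y y' => ind (Sk k) y * ind (Sk k) y' * ((((1 - θA * cr)⁻¹ * βQ * cr) * rR + ((β + (β₁ + ct * β)) * (1 - (β + (β₁ + ct * β)) * (R * cr) * cr)⁻¹) * rR' + ((β + (β₁ + ct * β)) * (1 - (β + (β₁ + ct * β)) * (R * cr) * cr)⁻¹) * rB) * Real.exp (-(ρ₃ * g.dist y y')))) := fun k =>
    hasMaj_covShapeEntry_loc₂ blk hB hBX hrR hrR' hrB (hREg k) (hRE'g k) (hBEg k) (hXr k) (hTX k)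
  have hT' : ∀ k, HasMaj (BlockNorm.ofBlocks g (liftBlk blk ι)) (BlockNorm.ofBlocks g (liftBlk blk ι)) (mulOp (fun p : X × ι => χX k p.1) ∘ₗ ((neumannR ((mulOp (fun p : X × ι => χtX k p.1) ∘ₗ N k) ∘ₗ (unstackM (C k) (A k) + NV k ∘ₗ projO (none : Option (J ⊕ J))) ∘ₗ
        stack LinearMap.id (fun j => Sum.elim (fun μ => fgrad n (liftEquiv (τ μ) ι)) (fun μ => bgrad n (liftEquiv (τ μ) ι)) j) ∘ₗ mulOp (fun p : X × ι => χX k p.1)) ∘ₗ (mulOp (fun p : X × ι => χtX k p.1) ∘ₗ Tb k ν)) ∘ₗ mmulOp (fun x => χX k x • (RE k ∘ ⇑(τ ν)) x) - (projO none ∘ₗ bgPropV (stack (mulOp (fun p : X × ι => χtX k p.1) ∘ₗ N k) (fun j => Sum.elim (fun μ => fgrad n (liftEquiv (τ μ) ι)) (fun μ => bgrad n (liftEquiv (τ μ) ι)) j ∘ₗ (mulOp (fun p : X × ι => χtX k p.1) ∘ₗ N k))) (unstackM (C k) (A k) + NV k ∘ₗ projO (none : Option (J ⊕ J)))) ∘ₗ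 mmulOp (fun x => χX k x • (fgradMat n (τ ν) (RE k)) x) + (projO none ∘ₗ bgPropV (stack (mulOp (fun p : X × ι => χtX k p.1) ∘ₗ N k) (fun j => Sum.elim (fun μ => fgrad n (liftEquiv (τ μ) ι)) (fun μ => bgrad n (liftEquiv (τ μ) ι)) j ∘ₗ (mulOp (fun p : X × ι => χtX k p.1) ∘ₗ N k))) (unstackM (C k) (A k) + NV k ∘ₗ projO (none : Option (J ⊕ J)))) ∘ₗ mmulOp (fun x => χX k x • BE k x))) (fun y y' => ind (Sk k) y * ind (Sk k) y' * ((((1 - θA * cr)⁻¹ * βQ * cr) * rR + ((β + (β₁ + ct * β)) * (1 - (β + (β₁ + ct * β)) * (R * cr) * cr)⁻¹) * rR' + ((β + (β₁ + ct * β)) * (1 - (β + (β₁ + ct * β)) * (R * cr) * cr)⁻¹) * rB) * Real.exp (-(ρ₃ * g.dist y y')))) := fun k =>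
    (hasMaj_diag_comp (liftBlk blk ι) (fun _ => zero_le_one) (hasMaj_mulOp (g := g) (liftBlk blk ι) (m := fun _ => (1 : ℝ)) (fun _ => zero_le_one) (fun p : X × ι => hχ1 k p.1))
      (hT2 k)).mono fun y y' => le_of_eq (one_mul _)
  -- (4) the sandwich against the conjugated right factor `M_{u_k}EM_{u_kᵀ} = M_{R_k}∇⁻_ν + M_{B_k}` (FILE 157 ★★ + the cut form)
  have hE2' : ∀ k, mulOp (fun p : X × ι => χX k p.1) ∘ₗ (projO none ∘ₗ bgPropV (stack (mulOp (fun p : X × ι => χtX k p.1) ∘ₗ N k) (fun j => Sum.elim (fun μ => fgrad n (liftEquiv (τ μ) ι)) (fun μ => bgrad n (liftEquiv (τ μ) ι)) j ∘ₗ (mulOp (fun p : X × ι => χtX k p.1) ∘ₗ N k))) (unstackM (C k) (A k) + NV k ∘ₗ projO (none : Option (J ⊕ J)))) ∘ₗ (mmulOp (ug k) ∘ₗ E ∘ₗ mmulOp (fun x => (ug k x)ᵀ)) ∘ₗ mulOp (fun p : X × ι => hX k (τ ν p.1)) =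
      (mulOp (fun p : X × ι => χX k p.1) ∘ₗ ((neumannR ((mulOp (fun p : X × ι => χtX k p.1) ∘ₗ N k) ∘ₗ (unstackM (C k) (A k) + NV k ∘ₗ projO (none : Option (J ⊕ J))) ∘ₗ
        stack LinearMap.id (fun j => Sum.elim (fun μ => fgrad n (liftEquiv (τ μ) ι)) (fun μ => bgrad n (liftEquiv (τ μ) ι)) j) ∘ₗ mulOp (fun p : X × ι => χX k p.1)) ∘ₗ (mulOp (fun p : X × ι => χtX k p.1) ∘ₗ Tb k ν)) ∘ₗ mmulOp (RE k ∘ ⇑(τ ν)) - (projO none ∘ₗ bgPropV (stack (mulOp (fun p : X × ι => χtX k p.1) ∘ₗ N k) (fun j => Sum.elim (fun μ => fgrad n (liftEquiv (τ μ) ι)) (fun μ => bgrad n (liftEquiv (τ μ) ι)) j ∘ₗ (mulOp (fun p : X × ι => χtX k p.1) ∘ₗ N k))) (unstackM (C k) (A k) + NV k ∘ₗ projO (none : Option (J ⊕ J)))) ∘ₗ mmulOp (fgradMat n (τ ν) (RE k)) + (projO none ∘ₗ bgPropV (stack (mulOp (fun p : X × ι => χtX k p.1) ∘ₗ N k) (fun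 j => Sum.elim (fun μ => fgrad n (liftEquiv (τ μ) ι)) (fun μ => bgrad n (liftEquiv (τ μ) ι)) j ∘ₗ (mulOp (fun p : X × ι => χtX k p.1) ∘ₗ N k))) (unstackM (C k) (A k) + NV k ∘ₗ projO (none : Option (J ⊕ J)))) ∘ₗ mmulOp (BE k))) ∘ₗ mulOp (fun p : X × ι => hX k (τ ν p.1)) := fun k => by
    rw [hEcov k]
    exact cut_sandwich_of_sandwich (a := fun p : X × ι => hX k (τ ν p.1)) (c := fun p : X × ι => χX k p.1)
      (smoothCutDressed_comp_covShape_bgrad_sandwich τ n (hDj k) (hunit k) (hχ k) (hunitW k) (τ ν) (RE k) (BE k) (hTb k ν)) (fun p hp => hlayν k p.1 hp)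
  have hE2'' : ∀ k, mulOp (fun p : X × ι => χX k p.1) ∘ₗ (projO none ∘ₗ bgPropV (stack (mulOp (fun p : X × ι => χtX k p.1) ∘ₗ N k) (fun j => Sum.elim (fun μ => fgrad n (liftEquiv (τ μ) ι)) (fun μ => bgrad n (liftEquiv (τ μ) ι)) j ∘ₗ (mulOp (fun p : X × ι => χtX k p.1) ∘ₗ N k))) (unstackM (C k) (A k) + NV k ∘ₗ projO (none : Option (J ⊕ J)))) ∘ₗ (mmulOp (ug k) ∘ₗ E ∘ₗ mmulOp (fun x => (ug k x)ᵀ)) ∘ₗ mulOp (fun p : X × ι => hX k (τ ν p.1)) =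
      (mulOp (fun p : X × ι => χX k p.1) ∘ₗ ((neumannR ((mulOp (fun p : X × ι => χtX k p.1) ∘ₗ N k) ∘ₗ (unstackM (C k) (A k) + NV k ∘ₗ projO (none : Option (J ⊕ J))) ∘ₗ
        stack LinearMap.id (fun j => Sum.elim (fun μ => fgrad n (liftEquiv (τ μ) ι)) (fun μ => bgrad n (liftEquiv (τ μ) ι)) j) ∘ₗ mulOp (fun p : X × ι => χX k p.1)) ∘ₗ (mulOp (fun p : X × ι => χtX k p.1) ∘ₗ Tb k ν)) ∘ₗ mmulOp (fun x => χX k x • (RE k ∘ ⇑(τ ν)) x) - (projO none ∘ₗ bgPropV (stack (mulOp (fun p : X × ι => χtX k p.1) ∘ₗ N k) (fun j => Sum.elim (fun μ => fgrad n (liftEquiv (τ μ) ι)) (fun μ => bgrad n (liftEquiv (τ μ) ι)) j ∘ₗ (mulOp (fun p : X × ι => χtX k p.1) ∘ₗ N k))) (unstackM (C k) (A k) + NV k ∘ₗ projO (none : Option (J ⊕ J)))) ∘ₗ mmulOp (fun x => χX k x • (fgradMat n (τ ν) (RE k)) x) + (projO none ∘ₗ bgPropV (stack (mulOp (fun p :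 X × ι => χtX k p.1) ∘ₗ N k) (fun j => Sum.elim (fun μ => fgrad n (liftEquiv (τ μ) ι)) (fun μ => bgrad n (liftEquiv (τ μ) ι)) j ∘ₗ (mulOp (fun p : X × ι => χtX k p.1) ∘ₗ N k))) (unstackM (C k) (A k) + NV k ∘ₗ projO (none : Option (J ⊕ J)))) ∘ₗ mmulOp (fun x => χX k x • BE k x))) ∘ₗ mulOp (fun p : X × ι => hX k (τ ν p.1)) := fun k => by
    have hχhs : mulOp (fun p : X × ι => χX k p.1) ∘ₗ mulOp (fun p : X × ι => hX k (τ ν p.1)) = mulOp (fun p : X × ι => hX k (τ ν p.1)) := by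
      refine LinearMap.ext fun f => funext fun p => ?_
      simp only [LinearMap.comp_apply, mulOp_apply]
      by_cases h0 : hX k (τ ν p.1) = 0
      · simp [h0]
      · rw [hlayν k p.1 h0, one_mul]
    rw [hE2' k, ← hTχ k]
    simp only [LinearMap.comp_assoc]
    rw [hχhs]
  -- (5) the adjoint remainder row in the cube's gauge: FILE 153 ★★★ against the model operator plus the far row
  have hK' : ∀ k, HasMaj (BlockNorm.ofBlocks g (liftBlk blk ι)) (BlockNorm.ofBlocks g (liftBlk blk ι)) ((projO none ∘ₗ bgPropV (stack (mulOp (fun p : X × ι => χtX k p.1) ∘ₗ N k) (fun j => Sum.elim (fun μ => fgrad n (liftEquiv (τ μ) ι)) (fun μ => bgrad n (liftEquiv (τ μ) ι)) j ∘ₗ (mulOp (fun p : X × ι => χtX k p.1) ∘ₗ N k))) (unstackM (C k) (A k) + NV k ∘ₗ projO (none : Option (J ⊕ J)))) ∘ₗ commOp (mmulOp (ug k) ∘ₗ Δ ∘ₗ mmulOp (fun x => (ug k x)ᵀ)) (fun p : X × ι => hX k p.1))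
      (fun y y' => ind (Sk k) y * (((((((Fintype.card J : ℝ) * (3 * ((β + (β₁ + ct * β)) * (1 - (β + (β₁ + ct * β)) * (R * cr) * cr)⁻¹ * c₂) + 2 * (((1 - θA * cr)⁻¹ * βQ * cr) * c₁)) + θW)
          + (β + (β₁ + ct * β)) * (1 - (β + (β₁ + ct * β)) * (R * cr) * cr)⁻¹ * cN * cr)
        + (((Fintype.card J : ℝ) * (2 * rA * (c₁ * ((β + (β₁ + ct * β)) * (1 - (β + (β₁ + ct * β)) * (R * cr) * cr)⁻¹) + c₀ * ((1 - θA * cr)⁻¹ * βQ * cr))))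
          + (β + (β₁ + ct * β)) * (1 - (β + (β₁ + ct * β)) * (R * cr) * cr)⁻¹ * ((ℓ * (Real.exp 1 * ε)⁻¹ + 2 * ω) * RN) * cr))) + θF) * Real.exp (-(ρ₃ * g.dist y y')))) := fun k => by
    rw [hcov k, commOp_add_left, LinearMap.comp_add]
    have h153 := hasMaj_smoothCutDressed_comp_commOp_cubeOp_out_of_sandwich blk τ n htri hd hsymm hd0 hrow hσ hβ hβ₁ hβQ hct hR hcr hc₀ hc₁ hc₂ hθW hcN hrA hRN hℓ hω hθA hε
      hσρ hρ₁V hρ₁G hρ₂ hρ₂₁ hρ₃ hρ₃N hρ₃V hρ₃₂ hρ₂W (hSχ k) (hSψ k) (hSψ₂ k) (hχt k) (hdχt k) (hdχtb k) (hsub k) (hχ k) (hs k) (hsb k) (hdd k) (hddb k) (hNψ k)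
      (hcut k) (hcutF k) (hcutB k) (hTf k) (hTb k) (hTfr k) (hTbr k) (hTfψ k) (hTbψ k) (hV k) hq (hW𝒲 k) hqA (hh1 k) (hh1b k) (hh0 k) (hLip k) (hrh k) (hh2 k) (hh2f k) (hh2b k)
      (hlayf k) (hlayb k) (hA k) (hWrow k) (hKN k) (hNV k)
    exact (h153.add (hFK k)).mono fun y y' => le_of_eq (by ring)
  -- FILE 160
  have hΘF : 0 ≤ (((((Fintype.card J : ℝ) * (3 * ((β + (β₁ + ct * β)) * (1 - (β + (β₁ + ct * β)) * (R * cr) * cr)⁻¹ * c₂) + 2 * (((1 - θA * cr)⁻¹ * βQ * cr) * c₁)) + θW)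
          + (β + (β₁ + ct * β)) * (1 - (β + (β₁ + ct * β)) * (R * cr) * cr)⁻¹ * cN * cr)
        + (((Fintype.card J : ℝ) * (2 * rA * (c₁ * ((β + (β₁ + ct * β)) * (1 - (β + (β₁ + ct * β)) * (R * cr) * cr)⁻¹) + c₀ * ((1 - θA * cr)⁻¹ * βQ * cr))))
          + (β + (β₁ + ct * β)) * (1 - (β + (β₁ + ct * β)) * (R * cr) * cr)⁻¹ * ((ℓ * (Real.exp 1 * ε)⁻¹ + 2 * ω) * RN) * cr))) + θF := add_nonneg hΘ hθF
  have hβ2 : 0 ≤ (((1 - θA * cr)⁻¹ * βQ * cr) * rR + ((β + (β₁ + ct * β)) * (1 - (β + (β₁ + ct * β)) * (R * cr) * cr)⁻¹) * rR' + ((β + (β₁ + ct * β)) * (1 - (β + (β₁ + ct * β)) * (R * cr) * cr)⁻¹) * rB) := by positivity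
  exact hasMaj_gluedL_comp_of_localGauges blk Sk ug Δ E hX χX (fun k x => hX k (τ ν x))
    (fun k => (projO none ∘ₗ bgPropV (stack (mulOp (fun p : X × ι => χtX k p.1) ∘ₗ N k) (fun j => Sum.elim (fun μ => fgrad n (liftEquiv (τ μ) ι)) (fun μ => bgrad n (liftEquiv (τ μ) ι)) j ∘ₗ (mulOp (fun p : X × ι => χtX k p.1) ∘ₗ N k))) (unstackM (C k) (A k) + NV k ∘ₗ projO (none : Option (J ⊕ J)))))
    (fun k => (mulOp (fun p : X × ι => χX k p.1) ∘ₗ ((neumannR ((mulOp (fun p : X × ι => χtX k p.1) ∘ₗ N k) ∘ₗ (unstackM (C k) (A k) + NV k ∘ₗ projO (none : Option (J ⊕ J))) ∘ₗ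
        stack LinearMap.id (fun j => Sum.elim (fun μ => fgrad n (liftEquiv (τ μ) ι)) (fun μ => bgrad n (liftEquiv (τ μ) ι)) j) ∘ₗ mulOp (fun p : X × ι => χX k p.1)) ∘ₗ (mulOp (fun p : X × ι => χtX k p.1) ∘ₗ Tb k ν)) ∘ₗ mmulOp (fun x => χX k x • (RE k ∘ ⇑(τ ν)) x) - (projO none ∘ₗ bgPropV (stack (mulOp (fun p : X × ι => χtX k p.1) ∘ₗ N k) (fun j => Sum.elim (fun μ => fgrad n (liftEquiv (τ μ) ι)) (fun μ => bgrad n (liftEquiv (τ μ) ι)) j ∘ₗ (mulOp (fun p : X × ι => χtX k p.1) ∘ₗ N k))) (unstackM (C k) (A k) + NV k ∘ₗ projO (none : Option (J ⊕ J)))) ∘ₗ mmulOp (fun x => χX k x • (fgradMat n (τ ν) (RE k)) x) + (projO none ∘ₗ bgPropV (stack (mulOp (fun p : X × ι => χtX k p.1) ∘ₗ N k) (fun j => Sum.elim (fun μ => fgrad n (liftEquiv (τ μ) ι)) (fun μ => bgrad n (liftEquiv (τ μ) ι)) j ∘ₗ (mulOp (fun p : X × ι => χtX k p.1) ∘ₗ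 N k))) (unstackM (C k) (A k) + NV k ∘ₗ projO (none : Option (J ⊕ J)))) ∘ₗ mmulOp (fun x => χX k x • BE k x))))
    (fun k => ((projO none ∘ₗ bgPropV (stack (mulOp (fun p : X × ι => χtX k p.1) ∘ₗ N k) (fun j => Sum.elim (fun μ => fgrad n (liftEquiv (τ μ) ι)) (fun μ => bgrad n (liftEquiv (τ μ) ι)) j ∘ₗ (mulOp (fun p : X × ι => χtX k p.1) ∘ₗ N k))) (unstackM (C k) (A k) + NV k ∘ₗ projO (none : Option (J ⊕ J)))) ∘ₗ F k ∘ₗ mulOp (fun p : X × ι => hX k p.1)))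
    htri hd hd0 hrow hσ hug hug' (dh := dh) hB hβ2 zero_le_one hc₁ hΘF hεF hNov hσρ₃ hleib hhcut hE2'' hhabs (fun k x => hhabs k (τ ν x)) hdh hN hGc hT' hK' hFX hqL

end Capstone

end Summit.QuantumFields.YangMills.BalabanUVNodes.N15.Gluing

end
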